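import Summits.Ventures.Crystal3D.Theorems.StickyWulffConstantNoReconstructionGainExactPrep
import Literature.Barriers.AtomisticToContinuum.HcpNotBravais
import Mathlib.Topology.Algebra.Order.Archimedean
import HarnessLib

/-!
# Cut alignment: the lattice heights are dense or cyclic (line `replication-exactness`)

HONEST FRAMING. Part of the venture `Summits/Ventures/Crystal3D` (cell `crystal3d-full`), supports the
crux `NoReconstructionGain` (stmt-Ventures-19144, route `route-Ventures-StickyWulffConstant`), line
`replication-exactness` (lead wulff-p1 g18).  Brick for the LOCAL replication licence
(`…ExactLocalReplication`): the set of lattice heights `{⟪t,ν⟫ : t ∈ Λ₀}` is an additive subgroup of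
`ℝ`, hence dense or cyclic (`AddSubgroup.dense_or_cyclic`); either way the cut of a half-crystal can be
re-chosen (same half-crystal) and translated by a lattice vector into any window `(y − ε, y]`, robustly
under further translations of small height.

* `exists_cut_alignment` — for every unit `ν`, cut `s` and target `y`: a cut `s₁` with
  `⟪p,ν⟫ ≤ s ↔ ⟪p,ν⟫ ≤ s₁` on `Λ₀` such that for every `0 < ε ≤ 1` some `t₀ ∈ Λ₀` and `0 < η ≤ 1` give
  `y − ε < s₁ + ⟪t₀ + t, ν⟫ ≤ y` for all `t ∈ Λ₀` with `|⟪t,ν⟫| < η` (dense case: approximation with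
  tolerance `ε/4`; cyclic case `bℤ`: exact hit, tolerance `min b 1`).

WHAT THIS IS NOT: the licence itself; the crux is not moved; rung F-C1 not moved.
-/

noncomputable section

namespace Summit.Ventures.Crystal3D.Theorems

open Summit.Ventures.Crystal3D
open Literature.MathematicalPhysics.StatisticalMechanics (fccStacking barlowStacking barlowPos barlowPos_mem
  constHagg)
open scoped InnerProductSpace

/-! ## Cut alignment -/

/-- **Cut alignment.**  For every unit `ν`, cut `s` and target level `y` there is a cut `s₁` defining
the SAME half-crystal (`⟪p,ν⟫ ≤ s ↔ ⟪p,ν⟫ ≤ s₁` on `Λ₀`) such that for every `0 < ε ≤ 1` some lattice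
vector `t₀` and some `0 < η ≤ 1` satisfy: every lattice vector `t` of height `|⟪t,ν⟫| < η` moves the
translated cut `s₁ + ⟪t₀ + t, ν⟫` into the window `(y − ε, y]` (the heights of `Λ₀` form a dense or a
cyclic subgroup of `ℝ`; in the cyclic case the window is hit exactly). -/
theorem exists_cut_alignment {ν : EuclideanSpace ℝ (Fin 3)} (hν : ‖ν‖ = 1) (s y : ℝ) :
    ∃ s₁ : ℝ, (∀ p ∈ fccStacking 1 (Real.sqrt (2 / 3)), ⟪p, ν⟫_ℝ ≤ s ↔ ⟪p, ν⟫_ℝ ≤ s₁) ∧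
      ∀ ε : ℝ, 0 < ε → ε ≤ 1 → ∃ t₀ ∈ fccStacking 1 (Real.sqrt (2 / 3)), ∃ η : ℝ, 0 < η ∧ η ≤ 1 ∧
        ∀ t ∈ fccStacking 1 (Real.sqrt (2 / 3)), |⟪t, ν⟫_ℝ| < η →
          y - ε < s₁ + ⟪t₀ + t, ν⟫_ℝ ∧ s₁ + ⟪t₀ + t, ν⟫_ℝ ≤ y := by
  classical
  -- the subgroup of lattice heights
  set G : AddSubgroup (EuclideanSpace ℝ (Fin 3)) :=
    Literature.Barriers.AtomisticToContinuum.barlowAddSubgroupOfConst 1 (Real.sqrt (2 / 3)) constHagg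
      (fun _ => rfl) with hG
  have hGmem : ∀ w, w ∈ G ↔ w ∈ fccStacking 1 (Real.sqrt (2 / 3)) := fun w => Iff.rfl
  set φ : EuclideanSpace ℝ (Fin 3) →+ ℝ := (innerSL ℝ ν).toLinearMap.toAddMonoidHom with hφ
  have hφapp : ∀ p, φ p = ⟪p, ν⟫_ℝ := by
    intro p; rw [hφ]; simp [real_inner_comm]
  set S : AddSubgroup ℝ := G.map φ with hS
  have hSmem : ∀ x, x ∈ S ↔ ∃ p ∈ fccStacking 1 (Real.sqrt (2 / 3)), ⟪p, ν⟫_ℝ = x := by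
    intro x
    rw [hS, AddSubgroup.mem_map]
    constructor
    · rintro ⟨p, hp, rfl⟩; exact ⟨p, (hGmem p).1 hp, (hφapp p).symm⟩
    · rintro ⟨p, hp, rfl⟩; exact ⟨p, (hGmem p).2 hp, hφapp p⟩
  rcases AddSubgroup.dense_or_cyclic S with hdense | ⟨a, ha⟩
  · -- dense: keep `s`, put `s + ⟪t₀,ν⟫` inside `(y − 3ε/4, y − ε/4)`, tolerance `η = ε/4`
    refine ⟨s, fun p _ => Iff.rfl, fun ε hε hε1 => ?_⟩
    obtain ⟨x, hxS, hxU⟩ := hdense.exists_mem_open isOpen_Ioo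
      (Set.nonempty_Ioo.2 (by linarith only [hε] : y - s - 3 * ε / 4 < y - s - ε / 4))
    obtain ⟨t₀, ht₀, hxt⟩ := (hSmem x).1 hxS
    refine ⟨t₀, ht₀, ε / 4, by linarith only [hε], by linarith only [hε1], fun t _ hth => ?_⟩
    rw [hxt.symm] at hxU
    rw [abs_lt] at hth
    rw [inner_add_left]
    constructor <;> linarith only [hxU.1, hxU.2, hth.1, hth.2]
  · -- cyclic: all heights are integer multiples of some `b > 0`
    have hmem : ∀ x, x ∈ S ↔ ∃ n : ℤ, n • a = x := by
      intro x; rw [ha, AddSubgroup.mem_closure_singleton]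
    have haS : a ∈ S := (hmem a).2 ⟨1, one_zsmul a⟩
    obtain ⟨pa, hpa, hpah⟩ := (hSmem a).1 haS
    have ha0 : a ≠ 0 := by
      intro h0
      have key : ∀ p ∈ fccStacking 1 (Real.sqrt (2 / 3)), ⟪p, ν⟫_ℝ = 0 := by
        intro p hp
        obtain ⟨n, hn⟩ := (hmem _).1 ((hSmem _).2 ⟨p, hp, rfl⟩)
        rw [← hn, h0, smul_zero]
      rcases inner_fcc_gen_ne_zero hν with h | h | h
      · exact h (key _ (barlowPos_mem _ _ _))
      · exact h (key _ (barlowPos_mem _ _ _))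
      · exact h (key _ (barlowPos_mem _ _ _))
    obtain ⟨b, hb, hbmem, pb, hpb, hpbh⟩ : ∃ b : ℝ, 0 < b ∧ (∀ x, x ∈ S → ∃ n : ℤ, (n : ℝ) * b = x) ∧
        ∃ pb ∈ fccStacking 1 (Real.sqrt (2 / 3)), ⟪pb, ν⟫_ℝ = b := by
      rcases lt_or_gt_of_ne ha0 with h | h
      · refine ⟨-a, by linarith only [h], fun x hx => ?_, -pa, fcc_neg_mem hpa,
          by rw [inner_neg_left, hpah]⟩
        obtain ⟨n, rfl⟩ := (hmem x).1 hx
        exact ⟨-n, by rw [zsmul_eq_mul]; push_cast; ring⟩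
      · refine ⟨a, h, fun x hx => ?_, pa, hpa, hpah⟩
        obtain ⟨n, rfl⟩ := (hmem x).1 hx
        exact ⟨n, by rw [zsmul_eq_mul]⟩
    have hsite : ∀ p ∈ fccStacking 1 (Real.sqrt (2 / 3)), ∃ n : ℤ, (n : ℝ) * b = ⟪p, ν⟫_ℝ :=
      fun p hp => hbmem _ ((hSmem _).2 ⟨p, hp, rfl⟩)
    -- brackets: `k b ≤ s < (k+1) b`, `k' b ≤ y < (k'+1) b`
    have hbr : ∀ x : ℝ, ((⌊x / b⌋ : ℤ) : ℝ) * b ≤ x ∧ x < (((⌊x / b⌋ : ℤ) : ℝ) + 1) * b := by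
      intro x
      constructor
      · calc ((⌊x / b⌋ : ℤ) : ℝ) * b ≤ x / b * b := mul_le_mul_of_nonneg_right (Int.floor_le _) hb.le
          _ = x := div_mul_cancel₀ _ hb.ne'
      · calc x = x / b * b := (div_mul_cancel₀ _ hb.ne').symm
          _ < (((⌊x / b⌋ : ℤ) : ℝ) + 1) * b := mul_lt_mul_of_pos_right (Int.lt_floor_add_one _) hb
    have hiff : ∀ (j k : ℤ) (x : ℝ), (k : ℝ) * b ≤ x → x < ((k : ℝ) + 1) * b →
        ((j : ℝ) * b ≤ x ↔ j ≤ k) := by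
      intro j k x h1 h2
      constructor
      · intro h
        have hjk : (j : ℝ) * b < ((k : ℝ) + 1) * b := lt_of_le_of_lt h h2
        have hjk' : (j : ℝ) < k + 1 := lt_of_mul_lt_mul_right hjk hb.le
        have hjk'' : j < k + 1 := by exact_mod_cast hjk'
        exact Int.lt_add_one_iff.1 hjk''
      · intro h
        have hjle : (j : ℝ) ≤ k := by exact_mod_cast h
        exact (mul_le_mul_of_nonneg_right hjle hb.le).trans h1
    set k : ℤ := ⌊s / b⌋ with hk
    set k' : ℤ := ⌊y / b⌋ with hk'
    obtain ⟨hks, hks'⟩ := hbr s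
    obtain ⟨hky, hky'⟩ := hbr y
    rw [← hk] at hks hks'
    rw [← hk'] at hky hky'
    -- the aligned cut
    refine ⟨y - ((k' : ℝ) - k) * b, fun p hp => ?_, fun ε hε _ => ?_⟩
    · obtain ⟨j, hj⟩ := hsite p hp
      rw [← hj, hiff j k s hks hks', hiff j k (y - ((k' : ℝ) - k) * b) (by linarith only [hky])
        (by linarith only [hky'])]
    · have hzs : (k' - k) • pb ∈ fccStacking 1 (Real.sqrt (2 / 3)) :=
        (hGmem _).1 (G.zsmul_mem ((hGmem _).2 hpb) (k' - k))
      refine ⟨(k' - k) • pb, hzs, min b 1, lt_min hb one_pos, min_le_right _ _, fun t ht hth => ?_⟩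
      -- a lattice height of absolute value `< b` vanishes
      obtain ⟨j, hj⟩ := hsite t ht
      have hj0 : j = 0 := by
        rw [← hj, abs_mul, abs_of_pos hb] at hth
        have h1 : |(j : ℝ)| * b < 1 * b := by linarith only [hth, min_le_left b 1]
        have h2 : |(j : ℝ)| < 1 := lt_of_mul_lt_mul_right h1 hb.le
        have h3 : |j| < 1 := by exact_mod_cast h2
        exact Int.abs_lt_one_iff.1 h3
      rw [hj0, Int.cast_zero, zero_mul] at hj
      have hin : ⟪(k' - k) • pb, ν⟫_ℝ = ((k' : ℝ) - k) * b := by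
        rw [← Int.cast_smul_eq_zsmul ℝ, real_inner_smul_left, hpbh]; push_cast; ring
      rw [inner_add_left, hin, ← hj]
      constructor <;> linarith only [hε]

end Summit.Ventures.Crystal3D.Theorems

end
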